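import Summits.Ventures.HSemireg.WedgeHankelRecurrenceWaringTop
import Summits.Ventures.HSemireg.WedgeHankelRecurrenceCensusPolar

/-!
# Venture HSemireg — THE FAMILIES OF REPRESENTATIONS: over an algebraically closed field with `N + 2 − r ≠ 0` in `K`, for a class `q` on `[0, N]` of middle rank `r ≥ 1`, `2r ≤ N + 1`,
# **the node sets of its `(N + 2 − r)`-term representations form an INFINITE set** (every coprime pencil `f + a·g` inside `Rec_{N+2−r}(q)` contributes one node set per good parameter, and
# `a ↦ roots(f + a·g)` is injective), while **an `r`-term representation, when it exists, has a UNIQUE node set** — the roots of the minimal recurrence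

HONEST FRAMING. Part of the Lean index of the computation cell `pub-hsemireg` (seat p10 gen 30, Sunday typer «UNIFORM-IN-n»).
LINEAR ALGEBRA OF HANKEL (catalecticant) MATRICES and of polynomials over a field ONLY: no variety, no cohomology theory, no sheaf, no Ext group and no semiregularity map is constructed
here; nothing here says that HC / HC_CM / HC_AV holds; no Literature fact is declared or used.  Custodian versions as in `WedgeHankelSiegelIdeal` (1/3); the dictionary («the variety of sums
of `N + 2 − r` powers of a binary form of border rank `r` is positive-dimensional; the minimal decomposition of rank `r` is unique», Sylvester ∕ Iarrobino–Kanev §1.3) is QUOTED in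
docstrings, never asserted — «infinitely many» is the infinitude of the set of NODE SETS.

WHAT IS IN THE TREE / CHAINED.  N66 (`WedgeHankelRecurrenceWaringSylvester`, № 424): `exists_isCoprime_mem_recSpace_beyond`, `exists_forall_rootMultiplicity_le_one`,
`exists_eq_C_mul_prod_X_sub_C_of_rootMultiplicity_le_one`, `prod_X_sub_C_mem_of_eq_C_mul`; N68 (`WedgeHankelRecurrenceWaringTop`, № 430): `natDegree_add_C_mul_eq`, `leadingCoeff_add_C_mul_eq` (and the
top-window special case `exists_secSeq_agree_top_of_rootMultiplicity_le_one` ∕ `infinite_setOf_nodes_top` of §632 below); N61 (№ 391) `prod_X_sub_C_mem_recSpace_of_secSeq_agree`; N43 (№ 323) `exists_smul_eq_of_mem_recSpace_self`;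
N51 (№ 340) `eq_of_eq_smul_of_monic`; N23 (№ 176) `exists_secSeq_of_prod_X_sub_C_mem_recSpace`; N19 (№ 174) `prod_X_sub_C_nodes_ne_zero`.  Mathlib: `Polynomial.roots_C_mul`, `roots_prod`,
`roots_X_sub_C`, `Multiset.bind_singleton`, `Finset.prod_image`, `Set.infinite_of_injOn_mapsTo`, `isCoprime_zero_right`, `Polynomial.roots_prod_X_sub_C`.
THIS FILE (namespace `Summit.Ventures.HSemireg.Wedge.HankelOuter` continued; CHAINED on N68 (N51 in the tree); 0 definitions):
* §632 THE ENGINE FOR ANY PENCIL (any level `N`, any window `d`; N68 did the top window): **`exists_secSeq_agree_of_rootMultiplicity_le_one`** (`f, g ∈ Rec^N_d(q)`,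
  `deg g < deg f = d`, `f + a·g` with simple roots over `k̄` ⇒ a `d`-term representation whose node set is `roots(f + a·g)`), **`infinite_setOf_nodes_of_isCoprime`** (coprime pencil, `(d : K) ≠ 0` ⇒
  infinitely many node sets of `d`-term representations).
* §633 **`infinite_setOf_nodes_beyond`** (`R^N(q) = r ≥ 1`, `2r ≤ N + 1`, `(N + 2 − r : K) ≠ 0`, `k̄`: the node sets of the `(N + 2 − r)`-term representations form an infinite set);
  **`image_eq_image_of_secSeq_agree`** (every field: two `r`-term representations of a class of rank `r`, `2r ≤ N + 1`, have the SAME node set), `subsingleton_setOf_nodes_self`.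
Nothing Ext-side.  New names only.
-/

open Module Polynomial
open scoped Matrix Polynomial

namespace Summit.Ventures.HSemireg.Wedge.HankelOuter

open Summit.Ventures.HSemireg.Wedge Summit.Ventures.HSemireg.Wedge.Hankel Summit.Ventures.HSemireg.Wedge.HankelSecant

variable (K : Type*) [Field K] {N : ℕ}

/-! ## §632. Any coprime pencil of recurrences gives infinitely many node sets -/

/-- **A MEMBER `f + a·g` WITH SIMPLE ROOTS GIVES A `d`-TERM REPRESENTATION WHOSE NODE SET IS ITS ROOT SET** (algebraically closed `K`; `f, g ∈ Rec^N_d(q)`, `deg g < deg f = d`; any `N`, `d`). -/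
theorem exists_secSeq_agree_of_rootMultiplicity_le_one [IsAlgClosed K] [DecidableEq K] {d : ℕ} {q : ℕ → K} {f g : K[X]} (hf : f ∈ recSpace K N q d) (hg : g ∈ recSpace K N q d)
    (hfd : f.natDegree = d) (hgd : g.natDegree < d) {a : K} (ha : ∀ x, (f + C a * g).rootMultiplicity x ≤ 1) :
    ∃ (lam A : Fin d → K), Function.Injective lam ∧ f + C a * g = C f.leadingCoeff * ∏ i, (Polynomial.X - C (lam i)) ∧
      Finset.univ.image lam = (f + C a * g).roots.toFinset ∧ ∀ j ≤ N, q j = secSeq K A lam j := by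
  have hpd : (f + C a * g).natDegree = d := natDegree_add_C_mul_eq hfd hgd a
  have hd : 1 ≤ d := by omega
  have hp0 : f + C a * g ≠ 0 := fun h => by rw [h, natDegree_zero] at hpd; omega
  obtain ⟨lam, hlam, hprod⟩ := exists_eq_C_mul_prod_X_sub_C_of_rootMultiplicity_le_one hpd ha
  have hmem : f + C a * g ∈ recSpace K N q d := Submodule.add_mem _ hf (by rw [Polynomial.C_mul']; exact Submodule.smul_mem _ a hg)
  obtain ⟨A, hA⟩ := exists_secSeq_of_prod_X_sub_C_mem_recSpace K hlam (prod_X_sub_C_mem_of_eq_C_mul hp0 hprod hmem)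
  have hlc : (f + C a * g).leadingCoeff ≠ 0 := leadingCoeff_ne_zero.mpr hp0
  have hroots : (f + C a * g).roots = (Finset.univ.val : Multiset (Fin d)).map lam := by
    rw [hprod, roots_C_mul _ hlc, roots_prod _ _ (prod_X_sub_C_nodes_ne_zero K lam)]
    simp_rw [roots_X_sub_C]
    exact Multiset.bind_singleton _ _
  refine ⟨lam, A, hlam, by rw [← leadingCoeff_add_C_mul_eq hfd hgd a]; exact hprod, ?_, hA⟩
  rw [hroots]
  ext x
  simp only [Finset.mem_image, Finset.mem_univ, true_and, Multiset.mem_toFinset, Multiset.mem_map, Finset.mem_val]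

/-- **A COPRIME PENCIL GIVES INFINITELY MANY NODE SETS: `f, g ∈ Rec^N_d(q)` coprime, `deg g < deg f = d`, `(d : K) ≠ 0`, `K` algebraically closed ⇒ the node sets of the `d`-term representations of `q`
on `[0, N]` form an infinite set** (`a ↦ roots(f + a·g)` is injective on the cofinite set of good parameters: `f + a·g = lc(f)·∏ (X − λ_i)` is recovered from the node set, and `a·g = a′·g ⇒ a = a′`). -/
theorem infinite_setOf_nodes_of_isCoprime [IsAlgClosed K] [DecidableEq K] {d : ℕ} {q : ℕ → K} {f g : K[X]} (hf : f ∈ recSpace K N q d) (hg : g ∈ recSpace K N q d) (hcop : IsCoprime f g)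
    (hfd : f.natDegree = d) (hgd : g.natDegree < d) (hchar : (d : K) ≠ 0) :
    {s : Finset K | ∃ (lam A : Fin d → K), Function.Injective lam ∧ Finset.univ.image lam = s ∧ ∀ j ≤ N, q j = secSeq K A lam j}.Infinite := by
  have hd : 1 ≤ d := by by_contra h; exact hchar (by rw [show d = 0 by omega, Nat.cast_zero])
  have hg0 : g ≠ 0 := by
    rintro rfl
    have hu := isCoprime_zero_right.mp hcop
    have := natDegree_eq_zero_of_isUnit hu
    omega
  set D : Set K := {a | ∀ x, (f + C a * g).rootMultiplicity x ≤ 1} with hD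
  have hDinf : D.Infinite := fun hfin => by
    obtain ⟨a, haS, ha⟩ := exists_forall_rootMultiplicity_le_one hcop (by rw [hfd]; exact hchar) hfin.toFinset
    exact haS (hfin.mem_toFinset.mpr ha)
  refine Set.infinite_of_injOn_mapsTo (f := fun a => (f + C a * g).roots.toFinset) (fun a ha a' ha' h => ?_) (fun a ha => ?_) hDinf
  · obtain ⟨lam, -, hlam, hprod, himg, -⟩ := exists_secSeq_agree_of_rootMultiplicity_le_one K hf hg hfd hgd ha
    obtain ⟨lam', -, hlam', hprod', himg', -⟩ := exists_secSeq_agree_of_rootMultiplicity_le_one K hf hg hfd hgd ha'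
    have hs : Finset.univ.image lam = Finset.univ.image lam' := by rw [himg, himg']; exact h
    have hpp : (∏ i, (Polynomial.X - C (lam i))) = ∏ i, (Polynomial.X - C (lam' i)) :=
      calc (∏ i, (Polynomial.X - C (lam i))) = ∏ x ∈ Finset.univ.image lam, (Polynomial.X - C x) :=
            (Finset.prod_image (f := fun x => Polynomial.X - C x) fun i _ j _ h => hlam h).symm
        _ = ∏ x ∈ Finset.univ.image lam', (Polynomial.X - C x) := by rw [hs]
        _ = ∏ i, (Polynomial.X - C (lam' i)) := Finset.prod_image (f := fun x => Polynomial.X - C x) fun i _ j _ h => hlam' h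
    have heq : f + C a * g = f + C a' * g := by rw [hprod, hprod', hpp]
    exact C_inj.mp (mul_right_cancel₀ hg0 (add_left_cancel heq))
  · obtain ⟨lam, A, hlam, -, himg, hA⟩ := exists_secSeq_agree_of_rootMultiplicity_le_one K hf hg hfd hgd ha
    exact ⟨lam, A, hlam, himg, hA⟩

/-! ## §633. Every class: infinitely many long representations, at most one short node set -/

/-- **INFINITELY MANY `(N + 2 − r)`-TERM REPRESENTATIONS: over an ALGEBRAICALLY CLOSED field with `(N + 2 − r : K) ≠ 0`, for `R^N(q) = r ≥ 1`, `2r ≤ N + 1`, the node sets of the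
`(N + 2 − r)`-term representations of `q` on `[0, N]` form an INFINITE set** (N66's coprime pencil inside `Rec_{N+2−r}(q)`). -/
theorem infinite_setOf_nodes_beyond [IsAlgClosed K] [DecidableEq K] {r : ℕ} {q : ℕ → K} (hq : (hankel1 K N (N / 2) q).rank = r) (hr : 1 ≤ r) (h2 : r + r ≤ N + 1)
    (hchar : ((N + 2 - r : ℕ) : K) ≠ 0) :
    {s : Finset K | ∃ (lam A : Fin (N + 2 - r) → K), Function.Injective lam ∧ Finset.univ.image lam = s ∧ ∀ j ≤ N, q j = secSeq K A lam j}.Infinite := by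
  obtain ⟨f, g, hf, hg, hcop, hfd, hgd⟩ := exists_isCoprime_mem_recSpace_beyond K hq hr h2
  exact infinite_setOf_nodes_of_isCoprime K hf hg hcop hfd hgd hchar

/-- **THE NODE SET OF A MINIMAL REPRESENTATION IS UNIQUE (every field): two `r`-term representations with distinct nodes of a class of rank `r` (`2r ≤ N + 1`) on `[0, N]` have the same node
set** — both node polynomials are monic members of the line `Rec_r(q)` (N61, N43, N51); no hypothesis on the weights (N23's `nodes_unique` assumed them non-zero). -/
theorem image_eq_image_of_secSeq_agree [DecidableEq K] {r : ℕ} {q : ℕ → K} (hq : (hankel1 K N (N / 2) q).rank = r) (h2 : r + r ≤ N + 1) {lam mu : Fin r → K} {A B : Fin r → K}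
    (hlam : Function.Injective lam) (hmu : Function.Injective mu) (hA : ∀ j ≤ N, q j = secSeq K A lam j) (hB : ∀ j ≤ N, q j = secSeq K B mu j) :
    Finset.univ.image lam = Finset.univ.image mu := by
  have h1 := prod_X_sub_C_mem_recSpace_of_secSeq_agree K hlam hA
  have h2' := prod_X_sub_C_mem_recSpace_of_secSeq_agree K hmu hB
  obtain ⟨c, hc⟩ := exists_smul_eq_of_mem_recSpace_self K hq h2 h1 (prod_X_sub_C_nodes_ne_zero K lam) h2'
  have heq := eq_of_eq_smul_of_monic K (Polynomial.monic_prod_of_monic _ _ fun i _ => Polynomial.monic_X_sub_C (lam i))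
    (Polynomial.monic_prod_of_monic _ _ fun i _ => Polynomial.monic_X_sub_C (mu i)) hc
  have hr1 : (∏ x ∈ Finset.univ.image lam, (Polynomial.X - C x)) = ∏ x ∈ Finset.univ.image mu, (Polynomial.X - C x) := by
    rw [Finset.prod_image (f := fun x => Polynomial.X - C x) fun i _ j _ h => hlam h, Finset.prod_image (f := fun x => Polynomial.X - C x) fun i _ j _ h => hmu h]
    exact heq
  have := congrArg Polynomial.roots hr1
  rwa [Polynomial.roots_prod_X_sub_C, Polynomial.roots_prod_X_sub_C, Finset.val_inj] at this

/-- **… so the set of node sets of `r`-term representations has at most one element.** -/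
theorem subsingleton_setOf_nodes_self [DecidableEq K] {r : ℕ} {q : ℕ → K} (hq : (hankel1 K N (N / 2) q).rank = r) (h2 : r + r ≤ N + 1) :
    {s : Finset K | ∃ (lam A : Fin r → K), Function.Injective lam ∧ Finset.univ.image lam = s ∧ ∀ j ≤ N, q j = secSeq K A lam j}.Subsingleton := by
  rintro s ⟨lam, A, hlam, rfl, hA⟩ s' ⟨mu, B, hmu, rfl, hB⟩
  exact image_eq_image_of_secSeq_agree K hq h2 hlam hmu hA hB

end Summit.Ventures.HSemireg.Wedge.HankelOuter
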